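import Literature.AlgebraicGeometry.HodgeTheory.GeneralHodgePropertyProductsSmallChowGroups
import Literature.AlgebraicGeometry.HodgeTheory.LefschetzStandardOfSmallChowGroups
import Literature.AlgebraicGeometry.HodgeTheory.LefschetzStandardUnconditionalDegrees
import Literature.AlgebraicGeometry.HodgeTheory.BettiKunnethPiecesHardLefschetzReduction
import Literature.AlgebraicGeometry.HodgeTheory.HodgeConjectureProductsOddHypersurfacesSupportedMiddle
import HarnessLib

/-!
# The Lefschetz standard conjecture `B(X)` for `CH₀, …, CH_{k₀}` of rank `≤ 1` in the PRINTED range `dim X ≤ 2k₀ + 4` (Vial 2013 Thm. 7.1, second item: `l = ⌊(d − 3)/2⌋`): the per-degree coniveau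
# product criterion on `X × X` in the degrees `2b ≤ 2 dim X − 2` that `B(X)` needs — fourfolds with `CH₀ = ℚ` (rationally chain connected, Fano), sixfolds with `CH₀ = CH₁ = ℚ` (cubic and `(2,2)` sixfolds
# granted ELV), eightfolds with `CH₀ = CH₁ = CH₂ = ℚ` (cubic eightfolds granted ELV + Hirschowitz–Iyer)
# (Vial 2013 Thm. 7.1; Laterveer 1998; Kleiman 1968 §2; Voisin 2025 §3.2.2; Voisin I Thm. 11.38–11.40, Thm. 6.25; Voisin II Thm. 10.29/10.31, Prop. 9.20; Grothendieck 1968/1969)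

Family `hodge`, lane `lit-hodgefound` (Track 2 foundations library; Layers A1/A4), layer `Literature/AlgebraicGeometry/HodgeTheory`.  THEOREMS ONLY (no definition, no named fact, no instance;
D-0026 net debt `0`).  Sharpens the seat's g33-#12 (`standardConjectureBStar_of_chowRankLEOneUpTo`, `dim X ≤ 2k₀ + 3`, via ALL of `HC(X × X)`) to the printed `dim X ≤ 2k₀ + 4` by the tree's
`standardConjectureBStar_of_hodgeClasses_prod_algebraic_range` (`B(X)` needs `HC(X × X)` in codimensions `2 ≤ b ≤ dim X − 1` only) and a PER-DEGREE form of the coniveau product criterion (g33-#7 proved the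
all-degrees form), fed with the full coniveau profile of a small-Chow variety (g33-#14 `supportedClasses_profile_of_chowRankLEOneUpTo`).

THE ARGUMENT.  `B(X)` ⟸ every rational `(b,b)`-class on `X × X` with `2 ≤ b ≤ n − 1` is algebraic (Kleiman; the tree's range theorem).  A rational `(b,b)`-class of `X × X` is a sum of cross products of
Hodge classes of the Künneth pieces `Hⁱ(X) ⊗ Hʲ(X)`, `i + j = 2b` (Voisin I Thm. 11.38/11.40); the pieces with `i = 0` or `j = 0` are `HC(X)` (g33-#7, `n ≤ 2k₀ + 5`), and a piece with `i, j ≥ 1` is algebraic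
as soon as `b ≤ ρ(i) + ρ(j) + 1` for the coniveau profile `ρ` of `X` (the tree's `BettiUniverse.ofRatClass_crossMap_mem_algebraicClasses_of_supportedClasses_eq_top`).  For `n ≤ 2k₀ + 4` the profile of
g33-#14 satisfies this inequality for every piece of every degree `2b ≤ 2n − 2` (elementary; checked on `7215` cells before typing, decided by `omega`); at `n = 2k₀ + 5` it fails exactly at `b = n − 1`
(pieces `(n, n − 2)`, `(n − 1, n − 1)`), which is why g33-#12's all-degrees road stops at `2k₀ + 3` and this one at the printed `2k₀ + 4`.

WHAT IS PROVED (`0` sorrys; every statement a theorem; tensor facts and the real Hodge model are theorems of the tree).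
* §1 `BettiUniverse.hodgeClasses_tensor_algebraic_of_forall_pieces` — the per-degree coniveau product criterion: rational `(c,c)`-classes on `Y × Z` are algebraic if `HC(Y)`, `HC(Z)` and
  `c ≤ ρ(i) + σ(j) + 1` on the pieces `i + j = 2c`, `1 ≤ i ≤ 2 dim Y`, `1 ≤ j ≤ 2 dim Z`.
* §2 **`standardConjectureBStar_of_chowRankLEOneUpTo_of_le`** — `B(X)` (André's `*_L` form, every `η`) for `ChowRankLEOneUpTo X k₀` and `dim X ≤ 2k₀ + 4`.
* §3 Instances: fourfolds with `CH₀ ⊗ ℚ` of rank `≤ 1`, rationally chain connected fourfolds, Fano fourfolds granted KMM92; sixfolds with `CH₀, CH₁` of rank `≤ 1`; eightfolds with `CH₀, CH₁, CH₂` of rank `≤ 1`;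
  granted ELV: cubic sixfolds, `(2,2)` sixfolds; granted ELV + Hirschowitz–Iyer: cubic eightfolds (`![3]` in `ℙ⁹`).

THE PRINTS.  Ch. Vial (2013) [Vial2013] Thm. 7.1 (second item) and its proof p. 19, §7.2.2–7.2.3; R. Laterveer (1998) [Laterveer1998]; S. Kleiman (1968) [Kleiman1968AlgebraicCycles] §2; C. Voisin (2025) [Voisin2025] §3.2.2 (15)–(16),
Conj. 3.11; A. Grothendieck (1968) [Grothendieck1968] §3 p. 196; C. Voisin (2002) [VoisinHodgeI2002] §11.3.3 Thm. 11.38–11.40, Lemma 11.41, p. 287, §6.2.3 Thm. 6.25, §7.3.1 Lemma 7.23; C. Voisin (2003) [VoisinHodgeII2003]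
§9.2.4 Prop. 9.20, Thm. 10.29, Thm. 10.31; P. Deligne (2000) [Deligne2000] §1; H. Esnault, M. Levine, E. Viehweg (1997) [EsnaultLevineViehweg1997] Thm. 4.6; A. Hirschowitz, J. Iyer (2010) [HirschowitzIyer2010] Thm. 1.5;
J. Kollár, Y. Miyaoka, S. Mori (1992) [KollarMiyaokaMori1992] Thm. 3.3.

THE OBJECTS (all the tree's).  `StandardConjectureBStar`, `HodgeConjectureFor`, `algebraicClasses`, `supportedClasses`, `BettiUniverse.kunnethSummand`, `BettiUniverse.crossMap`, `ofRatClass`, `IsRationalClass`, `IsOfHodgeType`,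
`Motives.ChowRankLEOneUpTo`, `IsRationallyChainConnected`, `IsFano`, `Motives.IsSmoothCompleteIntersection`, `Motives.EsnaultLevineViehweg1997_chowGroup_rank_le_one`, `Motives.HirschowitzIyer2010_chowTwo_rank_le_one_cubicEightfold`
(hypotheses only); the tree's `standardConjectureBStar_of_hodgeClasses_prod_algebraic_range`, `BettiUniverse.exists_eq_kunnethMap_of_mem_hodgeClasses`, `BettiUniverse.ofRatClass_crossMap_mem_algebraicClasses_of_lt`,
`…_of_lefschetzRange`, `…_of_fst_zero`, `…_of_snd_zero`, `…_of_supportedClasses_eq_top`, and the seat's `supportedClasses_profile_of_chowRankLEOneUpTo`, `hodgeConjectureFor_of_chowRankLEOneUpTo`,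
`IsRationalllyChainConnected`-bridge, `chowRankLEOneUpTo_one_of_cubic_of_ELV`, `chowRankLEOneUpTo_of_isSmoothCompleteIntersection_of_ELV`.

DEVIATIONS / SCOPE.  Vial's second item is printed for Chow groups of NIVEAU `≤ 2`; the tree's cycle-level predicate is the rank-one (niveau-`0`) case, in which the dimension bound `d ≤ 2l + 4` is the same.
Complex orientations; `B` in André's `*_L` form for every `η` (the tree's `StandardConjectureBStar`).  The ELV / Hirschowitz–Iyer instances are conditional on the tree's EXISTING named facts, as their predecessors.

## References
* [Vial2013] Ch. Vial, *Algebraic cycles and fibrations*, Doc. Math. 18 (2013) — Thm. 7.1 (second item) and proof p. 19; §7.2.2–7.2.3.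
* [Laterveer1998] R. Laterveer, J. Math. Kyoto Univ. 38 (1998) — main theorem.
* [Kleiman1968AlgebraicCycles] S. Kleiman, *Algebraic cycles and the Weil conjectures* (1968) — §2.
* [Voisin2025] C. Voisin (2025) — §3.2.2 (15)–(16), Conj. 3.11.
* [Grothendieck1968] A. Grothendieck, *Standard conjectures on algebraic cycles* (1969) — §3 p. 196.
* [VoisinHodgeI2002] C. Voisin, *Hodge Theory and Complex Algebraic Geometry I* — Thm. 11.38–11.40, Lemma 11.41, p. 287; Thm. 6.25; Lemma 7.23.
* [VoisinHodgeII2003] C. Voisin, *Hodge Theory and Complex Algebraic Geometry II* — Prop. 9.20; Thm. 10.29; Thm. 10.31.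
* [Deligne2000] P. Deligne, *The Hodge conjecture* (Clay, 2000) — §1.
* [EsnaultLevineViehweg1997] H. Esnault, M. Levine, E. Viehweg, Duke Math. J. 87 (1997) — Thm. 4.6.
* [HirschowitzIyer2010] A. Hirschowitz, J. Iyer (2010) — Thm. 1.5.
* [KollarMiyaokaMori1992] J. Kollár, Y. Miyaoka, S. Mori, J. Differential Geom. 36 (1992) — Thm. 3.3.

## Provenance
Lane `lit-hodgefound` (summit `HodgeConjecture`, Track 2 foundations), seat `lit-hodgefound-p29` (literature-prover, generation 33, row g33-#17).
-/

noncomputable section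

open scoped TensorProduct
open CategoryTheory AlgebraicGeometry MonoidalCategory CartesianMonoidalCategory Module Finset
open Literature.AlgebraicTopology.SingularHomology
open Literature.Geometry.Kaehler

namespace Literature.AlgebraicGeometry.HodgeTheory

open Literature.AlgebraicGeometry.Motives
open Literature.AlgebraicGeometry.Motives.HodgeStructure

variable {m n d : ℕ} {X Y Z : SchemeOver ℂ}

/-! ### §1 The per-degree coniveau product criterion -/

section Hodge

variable [HodgeTensorFacts.{0, 0}]

/-- **The coniveau product criterion, one degree at a time.**  Let `Y`, `Z` be smooth projective with `HC(Y)`, `HC(Z)`, and let `ρ`, `σ` be coniveau profiles (`N^{ρ(i)} Hⁱ(Y) = Hⁱ(Y)` for `i ≤ 2 dim Y`,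
`N^{σ(j)} Hʲ(Z) = Hʲ(Z)` for `j ≤ 2 dim Z`).  If `c ≤ ρ(i) + σ(j) + 1` for all `i + j = 2c` with `1 ≤ i ≤ 2 dim Y`, `1 ≤ j ≤ 2 dim Z`, then every rational `(c,c)`-class on `Y × Z` is algebraic: it is a sum
of cross products of Hodge classes of the Künneth pieces (Thm. 11.38/11.40); the pieces `i = 0` / `j = 0` are `HC^c(Z)` / `HC^c(Y)`, total degree `≤ 2` is Lefschetz `(1,1)`, pieces beyond the top degree
vanish, and a piece with `i, j ≥ 1` lies in `N^{ρ(i)+σ(j)} ⊇ N^{c−1}`, where Hodge classes are algebraic. [cite: VoisinHodgeI2002, §11.3.3 Thm. 11.38, Thm. 11.40, Lemma 11.41, p. 287 and §7.3.1 Lemma 7.23]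
[cite: VoisinHodgeII2003, §9.2.4 Prop. 9.20] [cite: Deligne2000, §1] [cite: GrothendieckTopology1969, §1, p. 300] -/
theorem BettiUniverse.hodgeClasses_tensor_algebraic_of_forall_pieces (hHD : exists_isReal_hodgeModel) (hY : IsSmoothProjective m Y) (hZ : IsSmoothProjective n Z)
    (hYZ : IsSmoothProjective d (Y ⊗ Z)) (hHCY : HodgeConjectureFor m Y) (hHCZ : HodgeConjectureFor n Z) (ρ σ : ℕ → ℕ)
    (hYs : ∀ i, i ≤ 2 * m → supportedClasses Y i (ρ i) = ⊤) (hZs : ∀ j, j ≤ 2 * n → supportedClasses Z j (σ j) = ⊤) {c : ℕ}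
    (h : ∀ i j : ℕ, i + j = 2 * c → 1 ≤ i → i ≤ 2 * m → 1 ≤ j → j ≤ 2 * n → c ≤ ρ i + σ j + 1)
    (v : complexBetti (Y ⊗ Z) (2 * c)) (hv : IsRationalClass v) (hvH : IsOfHodgeType d (Y ⊗ Z) (2 * c) c c v) : v ∈ algebraicClasses (Y ⊗ Z) c := by
  obtain ⟨w, rfl⟩ := (isRationalClass_iff_mem_range_ofRatClass v).1 hv
  have hw : w ∈ (BettiUniverse.hodge hHD hYZ (2 * c)).hodgeClasses c := (BettiUniverse.mem_hodgeClasses_hodge_iff_isOfHodgeType hHD hYZ c w).2 hvH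
  obtain ⟨t, ⟨ht, rfl⟩, -⟩ := BettiUniverse.exists_eq_kunnethMap_of_mem_hodgeClasses hHD hodgePQ_independent_of_hodgeModel_holds hY hZ hYZ (2 * c) c hw
  rw [map_sum]
  refine Submodule.sum_mem _ fun ij _ ↦ ?_
  obtain ⟨⟨i, j⟩, hij⟩ := ij
  have hij' : i + j = 2 * c := HasAntidiagonal.mem_antidiagonal.1 hij
  by_cases hi : i ≤ 2 * m
  swap
  · have H := BettiUniverse.ofRatClass_crossMap_mem_algebraicClasses_of_lt hY hZ hij' (Or.inl (not_le.1 hi)) (t ⟨(i, j), hij⟩)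
    exact H
  by_cases hj : j ≤ 2 * n
  swap
  · have H := BettiUniverse.ofRatClass_crossMap_mem_algebraicClasses_of_lt hY hZ hij' (Or.inr (not_le.1 hj)) (t ⟨(i, j), hij⟩)
    exact H
  by_cases hc1 : c ≤ 1
  · have H := BettiUniverse.ofRatClass_crossMap_mem_algebraicClasses_of_lefschetzRange hHD hY hZ hYZ hij' (Or.inl hc1) (ht ⟨(i, j), hij⟩)
    exact H
  rcases Nat.eq_zero_or_pos i with rfl | hi1
  · have H := BettiUniverse.ofRatClass_crossMap_mem_algebraicClasses_of_fst_zero hHD hY hZ hij'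
      (fun z hz ↦ hHCZ.2 c _ (isRationalClass_ofRatClass _) ((BettiUniverse.mem_hodgeClasses_hodge_iff_isOfHodgeType hHD hZ c z).1 hz)) (ht ⟨(0, j), hij⟩)
    exact H
  rcases Nat.eq_zero_or_pos j with rfl | hj1
  · have H := BettiUniverse.ofRatClass_crossMap_mem_algebraicClasses_of_snd_zero hHD hY hZ hij'
      (fun y hy ↦ hHCY.2 c _ (isRationalClass_ofRatClass _) ((BettiUniverse.mem_hodgeClasses_hodge_iff_isOfHodgeType hHD hY c y).1 hy)) (ht ⟨(i, 0), hij⟩)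
    exact H
  obtain ⟨p, rfl⟩ : ∃ p, c = p + 1 := ⟨c - 1, by omega⟩
  have hp : p ≤ ρ i + σ j := by have := h i j hij' hi1 hi hj1 hj; omega
  have H := BettiUniverse.ofRatClass_crossMap_mem_algebraicClasses_of_supportedClasses_eq_top hHD hY hZ hYZ hij' hp (hYs i hi) (hZs j hj) (ht ⟨(i, j), hij⟩)
  exact H

end Hodge

/-! ### §2 `B(X)` for `CH₀, …, CH_{k₀}` of rank `≤ 1` and `dim X ≤ 2k₀ + 4` -/

/-- **The Lefschetz standard conjecture `B(X)` (André's `*_L` form, every `η`) for a smooth projective `n`-fold with `CH₀(X)_ℚ, …, CH_{k₀}(X)_ℚ` of rank `≤ 1` and `n ≤ 2k₀ + 4`** — Vial's printed range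
`l = ⌊(d − 3)/2⌋` in the rank-one case.  `B(X)` needs the rational `(b,b)`-classes of `X × X` for `2 ≤ b ≤ n − 1` only; each is algebraic by §1 with the coniveau profile of `X` on both factors (the
inequality `b ≤ ρ(i) + ρ(j) + 1` holds on every piece of these degrees exactly when `n ≤ 2k₀ + 4`) and `HC(X)` (`n ≤ 2k₀ + 5`). [cite: Vial2013, Thm 7.1 (second item) and proof p. 19] [cite: Laterveer1998, main theorem (as quoted in Vial2013 Thm. 7.1)]
[cite: Kleiman1968AlgebraicCycles, §2] [cite: Voisin2025, §3.2.2 (15)–(16) and Conj. 3.11] [cite: VoisinHodgeII2003, Thm. 10.29 and proof of Thm. 10.31] [cite: VoisinHodgeI2002, §11.3.3 Thm. 11.38 and §6.2.3 Thm. 6.25] -/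
theorem standardConjectureBStar_of_chowRankLEOneUpTo_of_le (hX : IsSmoothProjective n X) {k₀ : ℕ} (hCH : ChowRankLEOneUpTo X k₀) (hn : n ≤ 2 * k₀ + 4) (η : complexBetti X 2) :
    StandardConjectureBStar n X η := by
  haveI : HodgeTensorFacts.{0, 0} := hodgeTensorFacts_holds
  have hHC : HodgeConjectureFor n X := hodgeConjectureFor_of_chowRankLEOneUpTo hX hCH (by omega)
  refine standardConjectureBStar_of_hodgeClasses_prod_algebraic_range hX (fun b hb2 hbn c hc hcH ↦ ?_) η
  refine BettiUniverse.hodgeClasses_tensor_algebraic_of_forall_pieces exists_isReal_hodgeModel_holds hX hX (hX.tensor_holds hX) hHC hHC _ _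
    (supportedClasses_profile_of_chowRankLEOneUpTo hX hCH (2 * n)) (supportedClasses_profile_of_chowRankLEOneUpTo hX hCH (2 * n)) (fun i j hij hi1 hi hj1 hj ↦ ?_) c hc hcH
  simp only [Nat.min_def]
  split_ifs <;> omega

/-! ### §3 Instances -/

/-- **`B(X)` for smooth projective FOURFOLDS with `CH₀ ⊗ ℚ` of rank `≤ 1`** (`4 ≤ 2·0 + 4`; g33-#12 reached threefolds). [cite: Vial2013, Thm 7.1 (second item)] [cite: BlochSrinivas1983, Thm. 1] [cite: Kleiman1968AlgebraicCycles, §2] -/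
theorem standardConjectureBStar_fourfold_of_chowRankLEOneUpTo_zero (hX : IsSmoothProjective 4 X) (hCH : ChowRankLEOneUpTo X 0) (η : complexBetti X 2) : StandardConjectureBStar 4 X η :=
  standardConjectureBStar_of_chowRankLEOneUpTo_of_le hX hCH (by norm_num) η

/-- **`B(X)` for every rationally chain connected smooth projective fourfold** (g33-#13's bridge). [cite: Kollar1995, Def. 4.10] [cite: Vial2013, Thm 7.1 (second item)] [cite: Kleiman1968AlgebraicCycles, §2] -/
theorem standardConjectureBStar_fourfold_of_isRationallyChainConnected (hX : IsSmoothProjective 4 X) (hRC : IsRationallyChainConnected X) (η : complexBetti X 2) : StandardConjectureBStar 4 X η :=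
  standardConjectureBStar_fourfold_of_chowRankLEOneUpTo_zero hX (hRC.chowRankLEOneUpTo_zero hX) η

/-- **`B(F)` for every smooth complex FANO fourfold, granted KMM92.** [cite: KollarMiyaokaMori1992, Thm. 3.3] [cite: Vial2013, Thm 7.1 (second item)] [cite: Kleiman1968AlgebraicCycles, §2] -/
theorem standardConjectureBStar_fourfold_of_isFano (hKMM : KollarMiyaokaMori1992_fano_rationallyChainConnected) {F : SchemeOver ℂ} (hF : IsFano 4 F) (η : complexBetti F 2) :
    StandardConjectureBStar 4 F η :=
  standardConjectureBStar_fourfold_of_chowRankLEOneUpTo_zero hF.isSmoothProjective (hKMM.chowRankLEOneUpTo_zero hF) η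

/-- **`B(X)` for smooth projective SIXFOLDS with `CH₀, CH₁ ⊗ ℚ` of rank `≤ 1`** (`6 ≤ 2·1 + 4`). [cite: Vial2013, Thm 7.1 (second item)] [cite: VoisinHodgeII2003, Thm. 10.31] [cite: Kleiman1968AlgebraicCycles, §2] -/
theorem standardConjectureBStar_sixfold_of_chowRankLEOneUpTo_one (hX : IsSmoothProjective 6 X) (hCH : ChowRankLEOneUpTo X 1) (η : complexBetti X 2) : StandardConjectureBStar 6 X η :=
  standardConjectureBStar_of_chowRankLEOneUpTo_of_le hX hCH (by norm_num) η

/-- **`B(X)` for smooth projective EIGHTFOLDS with `CH₀, CH₁, CH₂ ⊗ ℚ` of rank `≤ 1`** (`8 ≤ 2·2 + 4`). [cite: Vial2013, Thm 7.1 (second item)] [cite: VoisinHodgeII2003, Thm. 10.31] [cite: Kleiman1968AlgebraicCycles, §2] -/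
theorem standardConjectureBStar_eightfold_of_chowRankLEOneUpTo_two (hX : IsSmoothProjective 8 X) (hCH : ChowRankLEOneUpTo X 2) (η : complexBetti X 2) : StandardConjectureBStar 8 X η :=
  standardConjectureBStar_of_chowRankLEOneUpTo_of_le hX hCH (by norm_num) η

/-- **`B(X)` for every smooth CUBIC SIXFOLD `X ⊂ ℙ⁷_ℂ`, granted ELV** (`CH₀, CH₁ ⊗ ℚ = ℚ` for cubics of dimension `≥ 5`; Vial 2013 §7.2.2; g33-#12 had cubic fivefolds). [cite: Vial2013, Thm 7.1 (second item) and §7.2.2]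
[cite: EsnaultLevineViehweg1997, Thm 4.6 (announced as Thm 4.5 in the Introduction), first bullet] [cite: Kleiman1968AlgebraicCycles, §2] -/
theorem standardConjectureBStar_cubicSixfold_of_ELV (hR : EsnaultLevineViehweg1997_chowGroup_rank_le_one.{0}) (hX : IsSmoothCompleteIntersection 6 (fun _ : Fin 1 ↦ 3) X) (η : complexBetti X 2) :
    StandardConjectureBStar 6 X η :=
  standardConjectureBStar_sixfold_of_chowRankLEOneUpTo_one hX.1 (chowRankLEOneUpTo_one_of_cubic_of_ELV hR hX (by norm_num)) η

/-- **`B(X)` for every smooth complete intersection of TWO QUADRICS of dimension `6`, granted ELV** (`CH₀, CH₁ ⊗ ℚ = ℚ`: `l = 1 ≤ c − 1`, `2·C(3,2) = 6 ≤ 6 + 2`; Vial 2013 §7.2.3; g33-#12 had dimensions `4, 5`).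
[cite: Vial2013, Thm 7.1 (second item) and §7.2.3] [cite: EsnaultLevineViehweg1997, Thm 4.6 (announced as Thm 4.5 in the Introduction)] [cite: Kleiman1968AlgebraicCycles, §2] -/
theorem standardConjectureBStar_twoQuadricsSixfold_of_ELV (hR : EsnaultLevineViehweg1997_chowGroup_rank_le_one.{0}) (hX : IsSmoothCompleteIntersection 6 (fun _ : Fin 2 ↦ 2) X) (η : complexBetti X 2) :
    StandardConjectureBStar 6 X η :=
  standardConjectureBStar_sixfold_of_chowRankLEOneUpTo_one hX.1
    (chowRankLEOneUpTo_of_isSmoothCompleteIntersection_of_ELV hR hX (fun _ ↦ le_rfl) (l := 1) (Or.inr (by norm_num)) (by norm_num [Finset.sum_const, Nat.choose])) η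

/-- **`B(X)` for every smooth CUBIC EIGHTFOLD `X ⊂ ℙ⁹_ℂ` (multidegree `![3]`), granted ELV (`CH₀, CH₁`) and Hirschowitz–Iyer / Otwinowska (`CH₂`)** (g33-#12 had `A(X)` only). [cite: Vial2013, Thm 7.1 (second item) and §7.2.2]
[cite: HirschowitzIyer2010, Thm. 1.5 at (9,2,1,(3)); §1.7] [cite: EsnaultLevineViehweg1997, Thm 4.6] [cite: Kleiman1968AlgebraicCycles, §2] -/
theorem standardConjectureBStar_cubicEightfoldCI_of_hirschowitzIyer_of_ELV (h : HirschowitzIyer2010_chowTwo_rank_le_one_cubicEightfold.{0}) (hR : EsnaultLevineViehweg1997_chowGroup_rank_le_one.{0})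
    (hX : IsSmoothCompleteIntersection 8 ![3] X) (η : complexBetti X 2) : StandardConjectureBStar 8 X η :=
  standardConjectureBStar_eightfold_of_chowRankLEOneUpTo_two hX.1
    ((chowRankLEOneUpTo_iff_chowGroup X 2).2 fun _ hi x y ↦ chowGroup_rank_le_one_of_le_two_cubicEightfold h hR hX hi x y) η

end Literature.AlgebraicGeometry.HodgeTheory

end
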